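import Summits.CriticalPhenomena.PercolationContinuityZ3.Theorems.PercNearOneGluingNoHeavyLowerTailSahiCombCopyKernel

/-!
# The comb (tensor-Bernstein) hierarchy for Sahi's `E_k`, V: the TYPED SHAPE LAWS of the `k`-copy comb array, uniform in `k`
# — COMB-ENDPOS ⟺ (M⁺-k), COMB-ENDMIN, COMB-UNI, COMB-ORDER1 — and the coordinate induction
# ENDMIN(k) ⟹ (M⁺-k) ⟹ Sahi's `C_k` on product measures

Support file of the one-cut programme (crux `NoHeavyLowerTail`, stmt-CriticalPhenomena-4575; cell `prim-masterthm`, seat P5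
"Lorentzian / complete-log-concavity test", report `run/shared/lean/prim/prim-masterthm/prim-masterthm-p5/P5-LORENTZIAN-TEST.md`
§7.3–§7.4; INEQ-CLAIMS rows COMB-UNI/ENDMIN).  Honest label: Sahi's `C_k` / the master statement (M⁺-k) are OPEN for `k ≥ 3`;
the shape laws below are CONJECTURES of ours (census-clean, exact, ≈ `2.4·10¹⁰` coefficient lines, `k ≤ 6`, `m ≤ 8`, the cell
`E_4`, `m = 4` EXHAUSTIVE by two independent engines — kit j084649 and ttrl cp-hpk `run/shared/lean/ttrl/hpk/ENDMIN.md`);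
what is PROVED here is the web of implications between them and the master family.

The P5 lane's outcome (report §0, §7): no Lorentzian / log-concavity / stability structure carries `E_k ≥ 0` (exact witnesses
at `m ≤ 6` for every candidate, plain line log-concavity included); what survives on the comb coefficients
`c_t = combCoeff(1_U; j[e ↦ t])`, `t = 0..k` (one line of the `k`-copy comb array of `…SahiCombCopyKernel`), is SHAPE:

* `combLine k U e j` — the coefficient line; `MasterFamilyCombCoeffNonneg k` — (M⁺-k) with THE coefficients (implies P3's
  existential `MasterFamilyCombPos k`, `masterFamilyCombPos_of_combCoeffNonneg`);
* `CombEndPos k` — "ends `≥ 0` ⟹ line `≥ 0`"; **`masterFamilyCombCoeffNonneg_iff_combEndPos`**: (M⁺-k) ⟺ ENDPOS(k) — the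
  master statement is a statement about single lines given their two ends (coordinate induction
  `SahiComb.combCoeff_ind_nonneg_of_endPos` through the face lemmas: the ends are coefficients of the `e`-sections);
* `CombEndMin k` — ENDMIN: `min(c_0, c_k) ≤ c_t`; `CombUnimodal k` — UNI: every line is unimodal (mode position free);
  `CombOrderOne k` — ORDER-1 (`k ≥ 2`): `c_0 ≤ c_1`, `c_k ≤ c_{k−1}` (prim-ineq-gen-4's COMB-M read at the ends);
* implications: UNI ⟹ ENDMIN ⟹ ENDPOS ⟺ (M⁺-k) ⟹ `MasterFamilyCombPos k` ⟹ `MasterFamilyNonneg k` (Sahi's `C_k` for every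
  product measure), all `k` (`masterFamilyNonneg_of_combEndMin`, `masterFamilyNonneg_of_combUnimodal`); ORDER-1(3) ⟹ ENDMIN(3)
  (`combEndMin_three_of_combOrderOne`: at `k = 3` the end-order law IS the invariant — gen-4's M-schema; for `k ≥ 4` it leaves
  `c_2..c_{k−2}` free and UNI/ENDMIN is the new, `k`-uniform content);
* small `k`: the laws hold for `k ≤ 1` (not vacuous, not trivially false).
Everything except the `@[conjecture]`-tagged statements is proved; axioms standard. [this work]
-/

noncomputable section

open scoped Classical

namespace Summit.CriticalPhenomena.PercolationContinuityZ3.Theorems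

open Finset Function
open Literature.Combinatorics.Sahi2008
open Literature.Probability.Percolation (DeterminedBy determinedBy_iff)
open Literature.Probability.Percolation.DecisionTree (ind ind_of_mem ind_of_not_mem ind_nonneg)
open SahiComb

/-! ### The typed shape laws of the comb array, uniform in `k`, and what they imply -/

section Shape

open SahiComb

/-- **The coefficient line** through the profile `j` along the axis `e`: `t ↦ combCoeff(1_{U_0},…,1_{U_{k−1}}; j[e ↦ t])`,
`t = 0,…,k` — one column of the `k`-copy comb array with the profile of the other coordinates frozen. [this work] -/
def combLine {ι : Type*} [Fintype ι] (k : ℕ) (U : Fin k → Set (Set ι)) (e : ι) (j : ι → ℕ) (t : ℕ) : ℝ :=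
  combCoeff k (fun i => ind (U i)) (update j e t)

/-- **(M⁺-k) in explicit-coefficient form**: every `k`-copy comb coefficient (tensor-Bernstein coefficient of
`p ↦ E_k(μ_p; 1_U)`, `combCoeff`) of every `k`-tuple of increasing events on every finite cube is `≥ 0`.  Implies P3's
`MasterFamilyCombPos k` (`masterFamilyCombPos_of_combCoeffNonneg`; the converse is uniqueness of Bernstein coefficients, not
in the tree) and hence `MasterFamilyNonneg k`.  THEOREM for `k ≤ 1` here; OPEN for `k ≥ 3` (census: MASTER-FAMILY.md §MASTER,
P3 HIERARCHY §4).  An obligation of our theories, never a fact. [this work] [status: open for k ≥ 3] -/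
@[conjecture] def MasterFamilyCombCoeffNonneg (k : ℕ) : Prop :=
  ∀ (ι : Type) [Fintype ι] (U : Fin k → Set (Set ι)), (∀ i, IsUpperSet (U i)) →
    ∀ j : ι → ℕ, 0 ≤ combCoeff k (fun i => ind (U i)) j

/-- **COMB-ENDMIN(k)** (P5 report §7.3; INEQ-CLAIMS row COMB-UNI/ENDMIN): along every axis `e` and through every profile `j`,
the coefficient line of a `k`-tuple of increasing events attains its minimum over `t = 0,…,k` at an END:
`min(c_0, c_k) ≤ c_t`.  The `k`-uniform inductive invariant: `CombEndMin k → MasterFamilyCombCoeffNonneg k`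
(`masterFamilyCombCoeffNonneg_of_combEndMin`, induction on the coordinates through the face lemmas).  Trivial for `k ≤ 1`
(`combEndMin_zero`, `combEndMin_one`); for `k = 3` it follows from ORDER-1 (`combEndMin_three_of_combOrderOne`); census-clean
with `0` violations on ≈ `2.4·10¹⁰` coefficient lines (`k ≤ 6`, `m ≤ 8`; `E_4` on `m = 4` EXHAUSTIVE by two independent engines,
kit j084649 and ttrl cp-hpk `hpk/ENDMIN.md`).  OPEN for `k ≥ 3`; an obligation of our theories, never a fact.
[this work] [status: open for k ≥ 3] -/
@[conjecture] def CombEndMin (k : ℕ) : Prop :=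
  ∀ (ι : Type) [Fintype ι] (U : Fin k → Set (Set ι)), (∀ i, IsUpperSet (U i)) →
    ∀ (e : ι) (j : ι → ℕ) (t : ℕ), t ≤ k → min (combLine k U e j 0) (combLine k U e j k) ≤ combLine k U e j t

/-- **COMB-ENDPOS(k)** — positivity propagates inward from the two ends of every line: if `c_0 ≥ 0` and `c_k ≥ 0` then
`c_t ≥ 0` for all `t ≤ k`.  This is exactly what the coordinate induction consumes, and it is EQUIVALENT to the explicit master
statement (`masterFamilyCombCoeffNonneg_iff_combEndPos`): (M⁺-k) is a statement about single coefficient lines given their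
ends.  Implied by COMB-ENDMIN(k) (`combEndPos_of_combEndMin`).  OPEN for `k ≥ 3`; an obligation, never a fact.
[this work] [status: open for k ≥ 3] -/
@[conjecture] def CombEndPos (k : ℕ) : Prop :=
  ∀ (ι : Type) [Fintype ι] (U : Fin k → Set (Set ι)), (∀ i, IsUpperSet (U i)) →
    ∀ (e : ι) (j : ι → ℕ) (t : ℕ), t ≤ k → 0 ≤ combLine k U e j 0 → 0 ≤ combLine k U e j k → 0 ≤ combLine k U e j t

/-- **COMB-UNI(k)** (P5 report §7.3): every coefficient line of a `k`-tuple of increasing events is UNIMODAL on `t = 0,…,k`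
(nondecreasing up to some mode `m ≤ k`, nonincreasing after it; the mode position is free — every centred variant is false).
Implies COMB-ENDMIN(k) (`combEndMin_of_combUnimodal`).  Census as for `CombEndMin`; NOT a log-concavity statement (plain line
log-concavity is false at `m = 5`, `hpk/CONDHARRIS.md` 642(B)).  OPEN for `k ≥ 3`; an obligation, never a fact.
[this work] [status: open for k ≥ 3] -/
@[conjecture] def CombUnimodal (k : ℕ) : Prop :=
  ∀ (ι : Type) [Fintype ι] (U : Fin k → Set (Set ι)), (∀ i, IsUpperSet (U i)) →
    ∀ (e : ι) (j : ι → ℕ), ∃ m, m ≤ k ∧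
      MonotoneOn (combLine k U e j) (Set.Icc 0 m) ∧ AntitoneOn (combLine k U e j) (Set.Icc m k)

/-- **COMB-ORDER1(k)** (prim-ineq-gen-4's COMB-M read at the two ends of every line; ttrl `topform` RESULTS 1–2, 6): for
`k ≥ 2`, `c_0 ≤ c_1` and `c_k ≤ c_{k−1}` on every coefficient line of a `k`-tuple of increasing events (guarded by `2 ≤ k`:
at `k = 1` the two inequalities would force `c_0 = c_1`, which is false).  Census-clean (`0` violations) on the exhaustive cells
`E_3` `m ≤ 5`, `E_4` `m ≤ 4`, `E_5` `m ≤ 4`.  At `k = 3` it already gives COMB-ENDMIN(3) (`combEndMin_three_of_combOrderOne`);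
for `k ≥ 4` it leaves `c_2,…,c_{k−2}` free.  OPEN for `k ≥ 3`; an obligation of our theories, never a fact.
[this work] [status: open for k ≥ 3] -/
@[conjecture] def CombOrderOne (k : ℕ) : Prop :=
  2 ≤ k → ∀ (ι : Type) [Fintype ι] (U : Fin k → Set (Set ι)), (∀ i, IsUpperSet (U i)) →
    ∀ (e : ι) (j : ι → ℕ), combLine k U e j 0 ≤ combLine k U e j 1 ∧ combLine k U e j k ≤ combLine k U e j (k - 1)

/-- **The coordinate induction behind ENDPOS(k) ⟹ (M⁺-k)** on one cube: if positivity propagates inward from the ends of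
every line for all `k`-tuples of increasing events of the cube `2^ι`, then every comb coefficient of every such tuple determined
by a coordinate set `S` is `≥ 0` — induction on `S`, the two ends of each line being comb coefficients of the `e`-sections
(face lemmas), which are determined by `S ∖ {e}`; the base is a tuple of trivial events. [this work] -/
theorem SahiComb.combCoeff_ind_nonneg_of_endPos {ι : Type*} [Fintype ι] {k : ℕ}
    (hE : ∀ (U : Fin k → Set (Set ι)), (∀ i, IsUpperSet (U i)) →
      ∀ (e : ι) (j : ι → ℕ) (t : ℕ), t ≤ k → 0 ≤ combLine k U e j 0 → 0 ≤ combLine k U e j k → 0 ≤ combLine k U e j t)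
    (S : Finset ι) :
    ∀ (U : Fin k → Set (Set ι)), (∀ i, IsUpperSet (U i)) → (∀ i, DeterminedBy (U i) (↑S : Set ι)) →
      ∀ j : ι → ℕ, 0 ≤ combCoeff k (fun i => ind (U i)) j := by
  induction S using Finset.induction_on with
  | empty =>
    intro U _ hUd j
    exact combCoeff_ind_nonneg_of_trivial U (fun i => eq_empty_or_univ_of_determinedBy_empty (hUd i)) j
  | insert e S heS ih =>
    intro U hU hUd j
    by_cases hje : j e ≤ k
    · have hsec : ∀ (b : Bool) (i : Fin k),
          IsUpperSet (secAt e b (U i)) ∧ DeterminedBy (secAt e b (U i)) (↑S : Set ι) := fun b i => by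
        refine ⟨isUpperSet_secAt e b (hU i), ?_⟩
        have h := determinedBy_secAt e b (hUd i)
        rwa [erase_insert heS] at h
      have h0 : 0 ≤ combCoeff k (fun i => ind (U i)) (update j e 0) := by
        rw [combCoeff_ind_eq_secAt_false U e (update_self e 0 j)]
        exact ih _ (fun i => (hsec false i).1) (fun i => (hsec false i).2) _
      have hk : 0 ≤ combCoeff k (fun i => ind (U i)) (update j e k) := by
        rw [combCoeff_ind_eq_secAt_true U e (update_self e k j)]
        exact ih _ (fun i => (hsec true i).1) (fun i => (hsec true i).2) _
      have hmain : 0 ≤ combCoeff k (fun i => ind (U i)) (update j e (j e)) := hE U hU e j (j e) hje h0 hk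
      rwa [update_eq_self] at hmain
    · exact (combCoeff_eq_zero_of_not_mem_box _ fun hj => hje (mem_box.1 hj e)).ge

/-- **ENDPOS(k) ⟺ (M⁺-k) (explicit form)**: nonnegativity of all `k`-copy comb coefficients of increasing tuples on all finite
cubes is equivalent to the line-local propagation law. [this work] -/
theorem masterFamilyCombCoeffNonneg_iff_combEndPos (k : ℕ) : MasterFamilyCombCoeffNonneg k ↔ CombEndPos k := by
  refine ⟨fun h ι _ U hU e j t _ _ _ => h ι U hU _, fun h ι _ U hU j => ?_⟩
  exact combCoeff_ind_nonneg_of_endPos (fun U hU e j t ht => h ι U hU e j t ht) Finset.univ U hU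
    (fun i => determinedBy_coe_univ (U i)) j

/-- ENDMIN(k) ⟹ ENDPOS(k). [this work] -/
theorem combEndPos_of_combEndMin {k : ℕ} (h : CombEndMin k) : CombEndPos k :=
  fun ι _ U hU e j t ht h0 hk => (le_min h0 hk).trans (h ι U hU e j t ht)

/-- **ENDMIN(k) ⟹ (M⁺-k) (explicit form)**: the end-minimum law for `k`-tuples of increasing events gives nonnegativity of
every `k`-copy comb coefficient on every finite cube. [this work] -/
theorem masterFamilyCombCoeffNonneg_of_combEndMin {k : ℕ} (h : CombEndMin k) : MasterFamilyCombCoeffNonneg k :=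
  (masterFamilyCombCoeffNonneg_iff_combEndPos k).2 (combEndPos_of_combEndMin h)

/-- **(M⁺-k) explicit ⟹ (M⁺-k) as a certificate** (P3's `MasterFamilyCombPos`). [this work] -/
theorem masterFamilyCombPos_of_combCoeffNonneg {k : ℕ} (h : MasterFamilyCombCoeffNonneg k) : MasterFamilyCombPos k :=
  fun ι _ U hU => combPos_of_combCoeff_nonneg (h ι U hU)

/-- **ENDMIN(k) ⟹ Sahi's `C_k` on product measures**: the end-minimum law for level `k` implies
`0 ≤ E_k(μ_p; 1_{U_0},…,1_{U_{k−1}})` for all increasing events on every finite cube and every `p` (`MasterFamilyNonneg k`).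
[this work] -/
theorem masterFamilyNonneg_of_combEndMin {k : ℕ} (h : CombEndMin k) : MasterFamilyNonneg k :=
  masterFamilyCombPos_le_masterFamilyNonneg k
    (masterFamilyCombPos_of_combCoeffNonneg (masterFamilyCombCoeffNonneg_of_combEndMin h))

/-- **UNI(k) ⟹ ENDMIN(k)**: a unimodal line takes its minimum at an end. [this work] -/
theorem combEndMin_of_combUnimodal {k : ℕ} (h : CombUnimodal k) : CombEndMin k := by
  intro ι _ U hU e j t ht
  obtain ⟨m, hm, hmono, hanti⟩ := h ι U hU e j
  by_cases htm : t ≤ m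
  · exact (min_le_left _ _).trans (hmono ⟨le_rfl, Nat.zero_le m⟩ ⟨Nat.zero_le t, htm⟩ (Nat.zero_le t))
  · exact (min_le_right _ _).trans (hanti ⟨(not_le.1 htm).le, ht⟩ ⟨hm, le_rfl⟩ ht)

/-- **UNI(k) ⟹ Sahi's `C_k` on product measures.** [this work] -/
theorem masterFamilyNonneg_of_combUnimodal {k : ℕ} (h : CombUnimodal k) : MasterFamilyNonneg k :=
  masterFamilyNonneg_of_combEndMin (combEndMin_of_combUnimodal h)

/-- **ORDER-1(3) ⟹ ENDMIN(3)**: at `k = 3` the two end inequalities `c_0 ≤ c_1`, `c_3 ≤ c_2` cover the whole line — this is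
prim-ineq-gen-4's M-schema; for `k ≥ 4` they leave `c_2,…,c_{k−2}` free and UNI/ENDMIN is the new content. [this work] -/
theorem combEndMin_three_of_combOrderOne (h : CombOrderOne 3) : CombEndMin 3 := by
  intro ι _ U hU e j t ht
  obtain ⟨h01, h32⟩ := h (by norm_num) ι U hU e j
  interval_cases t
  · exact min_le_left _ _
  · exact (min_le_left _ _).trans h01
  · exact (min_le_right _ _).trans h32
  · exact min_le_right _ _

/-- **ORDER-1(3) ⟹ Sahi's `C_3` on product measures** (Kahn's Conjecture 5 would follow from the `k = 3` end-order law of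
the three-copy comb array). [this work] -/
theorem masterFamilyNonneg_three_of_combOrderOne (h : CombOrderOne 3) : MasterFamilyNonneg 3 :=
  masterFamilyNonneg_of_combEndMin (combEndMin_three_of_combOrderOne h)

/-! ### Small `k`: the laws are not vacuous -/

/-- `E_0`: all comb coefficients vanish. [this work] -/
theorem SahiComb.combCoeff_zero_eq {ι : Type*} [Fintype ι] (f : Fin 0 → Set ι → ℝ) (j : ι → ℕ) : combCoeff 0 f j = 0 :=
  sum_eq_zero fun _ _ => rfl

/-- `E_1(1_U) = μ_p(U)`: the comb coefficients are the fibre counts `#{ω : profile j, ω_0 ∈ U} ≥ 0`. [this work] -/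
theorem SahiComb.combCoeff_one_ind_nonneg {ι : Type*} [Fintype ι] (U : Fin 1 → Set (Set ι)) (j : ι → ℕ) :
    0 ≤ combCoeff 1 (fun i => ind (U i)) j :=
  sum_nonneg fun ω _ => ind_nonneg (U 0) (ω 0)

/-- (M⁺-0), explicit form. [this work] -/
theorem masterFamilyCombCoeffNonneg_zero : MasterFamilyCombCoeffNonneg 0 :=
  fun _ _ U _ j => (combCoeff_zero_eq (fun i => ind (U i)) j).ge

/-- (M⁺-1), explicit form. [this work] -/
theorem masterFamilyCombCoeffNonneg_one : MasterFamilyCombCoeffNonneg 1 :=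
  fun _ _ U _ j => combCoeff_one_ind_nonneg U j

/-- ENDMIN(0) (all lines are identically `0`). [this work] -/
theorem combEndMin_zero : CombEndMin 0 := by
  intro ι _ U hU e j t ht
  simp only [combLine, combCoeff_zero_eq, min_self, le_refl]

/-- ENDMIN(1) (a line has only its two ends). [this work] -/
theorem combEndMin_one : CombEndMin 1 := by
  intro ι _ U hU e j t ht
  interval_cases t
  · exact min_le_left _ _
  · exact min_le_right _ _

end Shape

end Summit.CriticalPhenomena.PercolationContinuityZ3.Theorems
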